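import Summits.Langlands.Langlands.Theses.RationalPeriodQuarter
import Literature.NumberTheory.Automorphic.BLZPeriodCocycle
import Literature.NumberTheory.Automorphic.PiecewiseRational

/-!
# Birth skeleton — piece `HeckeCosetPermutation` of the decomposition of `HeckePreservesRationalPeriods`
(route RationalPeriodQuarter, parent crux stmt-Langlands-2807; strategist planner-cstrat-stmt-Langlands-2807-r1-0)

Two registered stubs — COVER (every translate `M_j γ`, `γ ∈ Γ₁(N)`, lies in one of the `p + 1`
cosets `Γ₁(N) M_k`; Diamond–Shurman §5.2, in the tree for the representative `(m n; N p)` as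
`HeckeTGamma1.existsUnique_option`, plus `Γ₁(N) σ (p 0;0 1) = Γ₁(N) σ' (p 0;0 1)` for `d_σ ≡ d_σ' ≡ p`)
and DISTINCT (the `p + 1` cosets are pairwise distinct) — and the kernel-checked composition
`HeckeCosetPermutation_of` (an injective self-map of `Fin (p+1)` is a permutation).
Sorries ONLY inside `stub_*`.
-/

noncomputable section

set_option linter.dupNamespace false

namespace Summit.Langlands.Langlands.Cruxes.HeckePreservesRationalPeriods.BirthHeckeCosetPermutation

open scoped MatrixGroups
open Literature.NumberTheory.Automorphic

/-- The piece, verbatim (child `HeckeCosetPermutation`; not yet a route decl). -/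
def HeckeCosetPermutation : Prop :=
  ∀ N : ℕ, 0 < N → ∀ p : ℕ, p.Prime → ¬ p ∣ N → ∀ σ ∈ CongruenceSubgroup.Gamma0 N, (((σ : Matrix (Fin 2) (Fin 2) ℤ) 1 1 : ℤ) : ZMod N) = (p : ZMod N) → let M : Fin (p + 1) → Matrix (Fin 2) (Fin 2) ℤ := (fun j : Fin (p + 1) => if (j : ℕ) < p then !![(1 : ℤ), ((j : ℕ) : ℤ); 0, (p : ℤ)] else (σ : Matrix (Fin 2) (Fin 2) ℤ) * !![(p : ℤ), 0; 0, 1]); ∀ γ ∈ CongruenceSubgroup.Gamma1 N, ∃ (e : Equiv.Perm (Fin (p + 1))) (δ : Fin (p + 1) → Matrix.SpecialLinearGroup (Fin 2) ℤ), ∀ j : Fin (p + 1), δ j ∈ CongruenceSubgroup.Gamma1 N ∧ M j * (γ : Matrix (Fin 2) (Fin 2) ℤ) = (δ j : Matrix (Fin 2) (Fin 2) ℤ) * M (e j)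

/-- The `p + 1` integer Hecke matrices (verbatim). -/
def heckeMatB (p : ℕ) (σ : SL(2, ℤ)) : Fin (p + 1) → Matrix (Fin 2) (Fin 2) ℤ := (fun j : Fin (p + 1) => if (j : ℕ) < p then !![(1 : ℤ), ((j : ℕ) : ℤ); 0, (p : ℤ)] else (σ : Matrix (Fin 2) (Fin 2) ℤ) * !![(p : ℤ), 0; 0, 1])

theorem heckeCosetPermutation_iff : HeckeCosetPermutation ↔
    ∀ N : ℕ, 0 < N → ∀ p : ℕ, p.Prime → ¬ p ∣ N → ∀ σ ∈ CongruenceSubgroup.Gamma0 N,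
      (((σ : Matrix (Fin 2) (Fin 2) ℤ) 1 1 : ℤ) : ZMod N) = (p : ZMod N) →
      ∀ γ ∈ CongruenceSubgroup.Gamma1 N, ∃ (e : Equiv.Perm (Fin (p + 1)))
        (δ : Fin (p + 1) → SL(2, ℤ)), ∀ j : Fin (p + 1), δ j ∈ CongruenceSubgroup.Gamma1 N ∧
          heckeMatB p σ j * (γ : Matrix (Fin 2) (Fin 2) ℤ) = (δ j : Matrix (Fin 2) (Fin 2) ℤ) * heckeMatB p σ (e j) :=
  Iff.rfl

/-- **stub_cover**: every `M_j γ` (`γ ∈ Γ₁(N)`) is `δ M_k` for some `k` and `δ ∈ Γ₁(N)` (the double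
coset `Γ₁(N) (1 0; 0 p) Γ₁(N)` is right-`Γ₁(N)`-stable and is the union of the `p + 1` cosets).
[cite: DiamondShurman2005, §5.2 and Prop. 5.2.1] -/
theorem stub_cover : ∀ N : ℕ, 0 < N → ∀ p : ℕ, p.Prime → ¬ p ∣ N → ∀ σ ∈ CongruenceSubgroup.Gamma0 N,
    (((σ : Matrix (Fin 2) (Fin 2) ℤ) 1 1 : ℤ) : ZMod N) = (p : ZMod N) →
    ∀ γ ∈ CongruenceSubgroup.Gamma1 N, ∀ j : Fin (p + 1), ∃ (k : Fin (p + 1)) (δ : SL(2, ℤ)),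
      δ ∈ CongruenceSubgroup.Gamma1 N ∧
        ((fun j : Fin (p + 1) => if (j : ℕ) < p then !![(1 : ℤ), ((j : ℕ) : ℤ); 0, (p : ℤ)] else (σ : Matrix (Fin 2) (Fin 2) ℤ) * !![(p : ℤ), 0; 0, 1])) j * (γ : Matrix (Fin 2) (Fin 2) ℤ) = (δ : Matrix (Fin 2) (Fin 2) ℤ) * ((fun j : Fin (p + 1) => if (j : ℕ) < p then !![(1 : ℤ), ((j : ℕ) : ℤ); 0, (p : ℤ)] else (σ : Matrix (Fin 2) (Fin 2) ℤ) * !![(p : ℤ), 0; 0, 1])) k := by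
  sorry

/-- **stub_distinct**: the `p + 1` cosets `Γ₁(N) M_j` are pairwise distinct. [cite: DiamondShurman2005, §5.2 (5.2)] -/
theorem stub_distinct : ∀ N : ℕ, 0 < N → ∀ p : ℕ, p.Prime → ¬ p ∣ N → ∀ σ ∈ CongruenceSubgroup.Gamma0 N,
    (((σ : Matrix (Fin 2) (Fin 2) ℤ) 1 1 : ℤ) : ZMod N) = (p : ZMod N) →
    ∀ j k : Fin (p + 1), ∀ δ ∈ CongruenceSubgroup.Gamma1 N,
      ((fun j : Fin (p + 1) => if (j : ℕ) < p then !![(1 : ℤ), ((j : ℕ) : ℤ); 0, (p : ℤ)] else (σ : Matrix (Fin 2) (Fin 2) ℤ) * !![(p : ℤ), 0; 0, 1])) j = (δ : Matrix (Fin 2) (Fin 2) ℤ) * ((fun j : Fin (p + 1) => if (j : ℕ) < p then !![(1 : ℤ), ((j : ℕ) : ℤ); 0, (p : ℤ)] else (σ : Matrix (Fin 2) (Fin 2) ℤ) * !![(p : ℤ), 0; 0, 1])) k → j = k := by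
  sorry

/-- **Composition**: cover + distinct ⟹ the permutation (injective self-map of a finite type).
[folklore] -/
theorem HeckeCosetPermutation_of :
    (∀ N : ℕ, 0 < N → ∀ p : ℕ, p.Prime → ¬ p ∣ N → ∀ σ ∈ CongruenceSubgroup.Gamma0 N,
      (((σ : Matrix (Fin 2) (Fin 2) ℤ) 1 1 : ℤ) : ZMod N) = (p : ZMod N) →
      ∀ γ ∈ CongruenceSubgroup.Gamma1 N, ∀ j : Fin (p + 1), ∃ (k : Fin (p + 1)) (δ : SL(2, ℤ)),
        δ ∈ CongruenceSubgroup.Gamma1 N ∧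
          ((fun j : Fin (p + 1) => if (j : ℕ) < p then !![(1 : ℤ), ((j : ℕ) : ℤ); 0, (p : ℤ)] else (σ : Matrix (Fin 2) (Fin 2) ℤ) * !![(p : ℤ), 0; 0, 1])) j * (γ : Matrix (Fin 2) (Fin 2) ℤ) = (δ : Matrix (Fin 2) (Fin 2) ℤ) * ((fun j : Fin (p + 1) => if (j : ℕ) < p then !![(1 : ℤ), ((j : ℕ) : ℤ); 0, (p : ℤ)] else (σ : Matrix (Fin 2) (Fin 2) ℤ) * !![(p : ℤ), 0; 0, 1])) k) →
    (∀ N : ℕ, 0 < N → ∀ p : ℕ, p.Prime → ¬ p ∣ N → ∀ σ ∈ CongruenceSubgroup.Gamma0 N,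
      (((σ : Matrix (Fin 2) (Fin 2) ℤ) 1 1 : ℤ) : ZMod N) = (p : ZMod N) →
      ∀ j k : Fin (p + 1), ∀ δ ∈ CongruenceSubgroup.Gamma1 N,
        ((fun j : Fin (p + 1) => if (j : ℕ) < p then !![(1 : ℤ), ((j : ℕ) : ℤ); 0, (p : ℤ)] else (σ : Matrix (Fin 2) (Fin 2) ℤ) * !![(p : ℤ), 0; 0, 1])) j = (δ : Matrix (Fin 2) (Fin 2) ℤ) * ((fun j : Fin (p + 1) => if (j : ℕ) < p then !![(1 : ℤ), ((j : ℕ) : ℤ); 0, (p : ℤ)] else (σ : Matrix (Fin 2) (Fin 2) ℤ) * !![(p : ℤ), 0; 0, 1])) k → j = k) →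
    HeckeCosetPermutation := by
  intro h1 h2
  refine heckeCosetPermutation_iff.mpr ?_
  intro N hN p hp hpN σ hσ hσp γ hγ
  choose k δ hδ using h1 N hN p hp hpN σ hσ hσp γ hγ
  have hG : ((γ : SL(2, ℤ)) : Matrix (Fin 2) (Fin 2) ℤ) * ((γ⁻¹ : SL(2, ℤ)) : Matrix (Fin 2) (Fin 2) ℤ) = 1 := by
    rw [← Matrix.SpecialLinearGroup.coe_mul, mul_inv_cancel, Matrix.SpecialLinearGroup.coe_one]
  have hinj : Function.Injective k := by
    intro j j' hjj'
    have e1 := (hδ j).2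
    have e2 := (hδ j').2
    rw [← hjj'] at e2
    have hD : (((δ j')⁻¹ : SL(2, ℤ)) : Matrix (Fin 2) (Fin 2) ℤ) * ((δ j' : SL(2, ℤ)) : Matrix (Fin 2) (Fin 2) ℤ) = 1 := by
      rw [← Matrix.SpecialLinearGroup.coe_mul, inv_mul_cancel, Matrix.SpecialLinearGroup.coe_one]
    have e3 : heckeMatB p σ (k j) = (((δ j')⁻¹ : SL(2, ℤ)) : Matrix (Fin 2) (Fin 2) ℤ) *
        (heckeMatB p σ j' * (γ : Matrix (Fin 2) (Fin 2) ℤ)) := by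
      change heckeMatB p σ j' * _ = _ * heckeMatB p σ (k j) at e2
      rw [e2, ← Matrix.mul_assoc, hD, Matrix.one_mul]
    refine h2 N hN p hp hpN σ hσ hσp j j' (δ j * (δ j')⁻¹) (mul_mem (hδ j).1 (inv_mem (hδ j').1)) ?_
    change heckeMatB p σ j * _ = _ * heckeMatB p σ (k j) at e1
    show heckeMatB p σ j = _ * heckeMatB p σ j'
    calc heckeMatB p σ j
        = heckeMatB p σ j * (γ : Matrix (Fin 2) (Fin 2) ℤ) * ((γ⁻¹ : SL(2, ℤ)) : Matrix (Fin 2) (Fin 2) ℤ) := by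
          rw [Matrix.mul_assoc, hG, Matrix.mul_one]
      _ = (δ j : Matrix (Fin 2) (Fin 2) ℤ) * ((((δ j')⁻¹ : SL(2, ℤ)) : Matrix (Fin 2) (Fin 2) ℤ) *
            (heckeMatB p σ j' * (γ : Matrix (Fin 2) (Fin 2) ℤ))) * ((γ⁻¹ : SL(2, ℤ)) : Matrix (Fin 2) (Fin 2) ℤ) := by
          rw [e1, e3]
      _ = ((δ j * (δ j')⁻¹ : SL(2, ℤ)) : Matrix (Fin 2) (Fin 2) ℤ) * heckeMatB p σ j' := by
          rw [Matrix.SpecialLinearGroup.coe_mul]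
          simp only [Matrix.mul_assoc, hG, Matrix.mul_one]
  have hbij : Function.Bijective k := hinj.bijective_of_finite
  refine ⟨Equiv.ofBijective k hbij, δ, fun j => ⟨(hδ j).1, ?_⟩⟩
  exact (hδ j).2

end Summit.Langlands.Langlands.Cruxes.HeckePreservesRationalPeriods.BirthHeckeCosetPermutation
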